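import Summits.Ventures.DiscreteObjects.UnitDistance.PlaneM1345
import Summits.Ventures.DiscreteObjects.UnitDistance.PlaneK61
import Summits.Ventures.DiscreteObjects.UnitDistance.SixChromatic
import Mathlib.Analysis.InnerProductSpace.PiL2
import Mathlib.Analysis.SpecialFunctions.Pow.Real
import HarnessLib

/-!
# `5 ≤ χ(ℝ²)` IN THE KERNEL: the plane is not 4-colourable (de Grey 2018), assembled from Parts 1 and 2 by plane isometries

Framing (verbatim for the cell): lottery ticket; floor = certified bounds/negative ranges.

THEOREM (de Grey, Geombinatorics 28 (2018) 18–31, arXiv:1804.02385): `χ(ℝ²) ≥ 5`.  This file makes it a hypothesis-free KERNEL theorem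
(`plane_not_colorable_four`, `five_le_chromaticNumber_plane`; standard axioms), following de Grey's two-part structure with the finite
computations replaced by the kernel searches of `PlaneM1345.lean` (Part 1: in de Grey's 1345-vertex `M` no proper 4-colouring makes the
central `√3`-triple monochromatic) and `PlaneK61.lean` (Part 2: in de Grey's 61-vertex `K`, if no `√3`-triple is monochromatic then the linking
diagonal — two points at distance `4` — is monochromatic), and the combination done NOT by building de Grey's 20425-vertex union graph but by
the symmetry of the plane: a 4-colouring `C` of the whole plane restricts to every isometric copy of `M` and `K`.
* `planeC_no_mono_otriple`: for every 4-colouring `C` of the unit-distance graph of `ℂ` and every positively oriented equilateral triple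
  `(x; y, z)` of side `√3` (`z − x = ω(y − x)`, `ω = e^{iπ/3}`), `C` is not constant on `{x, y, z}` — apply Part 1 to `C ∘ φ` for the direct
  isometry `φ` taking `M`'s central triple `(1; ω², ω⁴)` to `(x; y, z)`.
* `planeC_dist_four`: hence (Part 2 applied to `C ∘ ψ`, `ψ` a direct isometry taking `K`'s diagonal `(2, −2)` to `(P, Q)`; direct
  isometries map positively oriented `√3`-triples to positively oriented `√3`-triples) any two points at distance `4` have the same colour.
* `planeC_not_colorable_four`: the points `0`, `4` and `(31 + 3√7·i)/8` are pairwise at distances `4, 4, 1` — contradiction.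
* transfer to `planeUnitDistanceGraph` (on `EuclideanSpace ℝ (Fin 2)`, `SixChromatic.lean`) along `Complex.orthonormalBasisOneI`.
The exact embeddings: `M`'s vertex `v` is the point `(a + b√33 + i(c√3 + d√11))/12` (`pt33 (M1345co v)`), `K`'s is
`(a + b√5 + i(c√3 + d√15))/16` (`pt5 (K61co v)`); the integer tests `unitB33`, `unitB5`, `orientedB5` of the data files imply unit distance /
oriented `√3`-triple (`norm_sub_pt33`, `norm_sub_pt5`, `otriple_pt5`).  Seat udg g9.  Not a claim of novelty for the theorem (de Grey's); the
formalisation — a kernel-checked proof of `χ(ℝ²) ≥ 5` with standard axioms — is the cell's.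
-/

namespace Summit.Ventures.DiscreteObjects.UnitDistance

open Complex

/-- The unit-distance graph of the complex plane. -/
def planeGraphC : SimpleGraph ℂ where
  Adj z w := ‖z - w‖ = 1
  symm := ⟨fun z w h => by rw [← norm_neg, neg_sub]; exact h⟩
  loopless := ⟨fun z (h : ‖z - z‖ = 1) => by simp at h⟩

/-- `ω = e^{iπ/3} = (1 + i√3)/2`. -/
noncomputable def omegaC : ℂ := ⟨1 / 2, Real.sqrt 3 / 2⟩

/-- A positively oriented equilateral triple of side `√3`: `‖y − x‖² = 3` and `z − x = ω·(y − x)`. -/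
def IsOTriple (x y z : ℂ) : Prop := ‖y - x‖ ^ 2 = 3 ∧ z - x = omegaC * (y - x)

/-- `√5·√5 = 5`. -/
theorem ms_sqrt5 : Real.sqrt 5 * Real.sqrt 5 = 5 := Real.mul_self_sqrt (by norm_num)
/-- `√7·√7 = 7`. -/
theorem ms_sqrt7 : Real.sqrt 7 * Real.sqrt 7 = 7 := Real.mul_self_sqrt (by norm_num)
/-- `√11·√11 = 11`. -/
theorem ms_sqrt11 : Real.sqrt 11 * Real.sqrt 11 = 11 := Real.mul_self_sqrt (by norm_num)
/-- `√15·√15 = 15`. -/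
theorem ms_sqrt15 : Real.sqrt 15 * Real.sqrt 15 = 15 := Real.mul_self_sqrt (by norm_num)
/-- `√33·√33 = 33`. -/
theorem ms_sqrt33 : Real.sqrt 33 * Real.sqrt 33 = 33 := Real.mul_self_sqrt (by norm_num)
/-- `√3·√11 = √33`. -/
theorem sqrt3_mul_sqrt11 : Real.sqrt 3 * Real.sqrt 11 = Real.sqrt 33 := by
  rw [← Real.sqrt_mul (by norm_num)]; norm_num
/-- `√3·√5 = √15`. -/
theorem sqrt3_mul_sqrt5 : Real.sqrt 3 * Real.sqrt 5 = Real.sqrt 15 := by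
  rw [← Real.sqrt_mul (by norm_num)]; norm_num
/-- `√3·√15 = 3√5`. -/
theorem sqrt3_mul_sqrt15 : Real.sqrt 3 * Real.sqrt 15 = 3 * Real.sqrt 5 := by
  rw [show (15 : ℝ) = 3 * 5 by norm_num, Real.sqrt_mul (by norm_num) 5, ← mul_assoc, Real.mul_self_sqrt (by norm_num)]

/-- `|(A + B√33 + i(C√3 + D√11))/12|² = 1` from the two integer-style identities. -/
theorem normSq_form33 (A B C D : ℝ) (h1 : A * A + 33 * B * B + 3 * C * C + 11 * D * D = 144) (h2 : A * B + C * D = 0) :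
    (A + B * Real.sqrt 33) / 12 * ((A + B * Real.sqrt 33) / 12) +
      (C * Real.sqrt 3 + D * Real.sqrt 11) / 12 * ((C * Real.sqrt 3 + D * Real.sqrt 11) / 12) = 1 := by
  linear_combination (1 / 144 : ℝ) * h1 + (Real.sqrt 33 / 72) * h2 + (B * B / 144) * ms_sqrt33 + (C * C / 144) * (Real.mul_self_sqrt (show (0 : ℝ) ≤ 3 by norm_num)) +
    (D * D / 144) * ms_sqrt11 + (C * D / 72) * sqrt3_mul_sqrt11

/-- `|(A + B√5 + i(C√3 + D√15))/16|² = S/256` when `A² + 5B² + 3C² + 15D² = S` and `AB + 3CD = 0`. -/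
theorem normSq_form5 (A B C D S : ℝ) (h1 : A * A + 5 * B * B + 3 * C * C + 15 * D * D = S) (h2 : A * B + 3 * C * D = 0) :
    (A + B * Real.sqrt 5) / 16 * ((A + B * Real.sqrt 5) / 16) +
      (C * Real.sqrt 3 + D * Real.sqrt 15) / 16 * ((C * Real.sqrt 3 + D * Real.sqrt 15) / 16) = S / 256 := by
  linear_combination (1 / 256 : ℝ) * h1 + (Real.sqrt 5 / 128) * h2 + (B * B / 256) * ms_sqrt5 + (C * C / 256) * (Real.mul_self_sqrt (show (0 : ℝ) ≤ 3 by norm_num)) +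
    (D * D / 256) * ms_sqrt15 + (C * D / 128) * sqrt3_mul_sqrt15

/-- Real part of `ω·(A + B√5 + i(C√3 + D√15))/16`. -/
theorem omega_mul_form5_re (A B C D A' B' : ℝ) (h3 : 2 * A' = A - 3 * C) (h4 : 2 * B' = B - 3 * D) :
    (A' + B' * Real.sqrt 5) / 16 =
      1 / 2 * ((A + B * Real.sqrt 5) / 16) - Real.sqrt 3 / 2 * ((C * Real.sqrt 3 + D * Real.sqrt 15) / 16) := by
  linear_combination (1 / 32 : ℝ) * h3 + (Real.sqrt 5 / 32) * h4 + (C / 32) * (Real.mul_self_sqrt (show (0 : ℝ) ≤ 3 by norm_num)) + (D / 32) * sqrt3_mul_sqrt15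

/-- Imaginary part of `ω·(A + B√5 + i(C√3 + D√15))/16`. -/
theorem omega_mul_form5_im (A B C D C' D' : ℝ) (h5 : 2 * C' = A + C) (h6 : 2 * D' = B + D) :
    (C' * Real.sqrt 3 + D' * Real.sqrt 15) / 16 =
      1 / 2 * ((C * Real.sqrt 3 + D * Real.sqrt 15) / 16) + Real.sqrt 3 / 2 * ((A + B * Real.sqrt 5) / 16) := by
  linear_combination (Real.sqrt 3 / 32 : ℝ) * h5 + (Real.sqrt 15 / 32) * h6 - (B / 32) * sqrt3_mul_sqrt5

/-- `‖z‖ = 1` from `normSq z = 1`, and `‖z‖² = normSq z`. -/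
theorem norm_eq_one_of_normSq {z : ℂ} (h : Complex.normSq z = 1) : ‖z‖ = 1 := by
  rw [Complex.norm_def, h, Real.sqrt_one]

/-- `‖z‖² = normSq z`. -/
theorem norm_sq_eq_normSq (z : ℂ) : ‖z‖ ^ 2 = Complex.normSq z := (Complex.normSq_eq_norm_sq z).symm

/-! ## The embeddings -/

/-- The point `(a + b√33 + i(c√3 + d√11))/12` (coordinates of `M`). -/
noncomputable def pt33 (p : ℤ × ℤ × ℤ × ℤ) : ℂ :=
  ⟨((p.1 : ℝ) + p.2.1 * Real.sqrt 33) / 12, ((p.2.2.1 : ℝ) * Real.sqrt 3 + p.2.2.2 * Real.sqrt 11) / 12⟩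

/-- The point `(a + b√5 + i(c√3 + d√15))/16` (coordinates of `K`). -/
noncomputable def pt5 (p : ℤ × ℤ × ℤ × ℤ) : ℂ :=
  ⟨((p.1 : ℝ) + p.2.1 * Real.sqrt 5) / 16, ((p.2.2.1 : ℝ) * Real.sqrt 3 + p.2.2.2 * Real.sqrt 15) / 16⟩

/-- Difference of two `pt33` points, componentwise. -/
theorem pt33_sub (p q : ℤ × ℤ × ℤ × ℤ) : pt33 p - pt33 q =
    ⟨(((p.1 : ℝ) - q.1) + ((p.2.1 : ℝ) - q.2.1) * Real.sqrt 33) / 12,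
      (((p.2.2.1 : ℝ) - q.2.2.1) * Real.sqrt 3 + ((p.2.2.2 : ℝ) - q.2.2.2) * Real.sqrt 11) / 12⟩ := by
  apply Complex.ext <;> simp [pt33] <;> ring

/-- Difference of two `pt5` points, componentwise. -/
theorem pt5_sub (p q : ℤ × ℤ × ℤ × ℤ) : pt5 p - pt5 q =
    ⟨(((p.1 : ℝ) - q.1) + ((p.2.1 : ℝ) - q.2.1) * Real.sqrt 5) / 16,
      (((p.2.2.1 : ℝ) - q.2.2.1) * Real.sqrt 3 + ((p.2.2.2 : ℝ) - q.2.2.2) * Real.sqrt 15) / 16⟩ := by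
  apply Complex.ext <;> simp [pt5] <;> ring

/-- `unitB33 p q` ⇒ `pt33 p`, `pt33 q` are at distance `1`. -/
theorem norm_sub_pt33 {p q : ℤ × ℤ × ℤ × ℤ} (h : unitB33 p q = true) : ‖pt33 p - pt33 q‖ = 1 := by
  simp only [unitB33, Bool.and_eq_true, beq_iff_eq] at h
  obtain ⟨h1, h2⟩ := h
  have h1' : ((p.1 : ℝ) - q.1) * ((p.1 : ℝ) - q.1) + 33 * ((p.2.1 : ℝ) - q.2.1) * ((p.2.1 : ℝ) - q.2.1) +
      3 * ((p.2.2.1 : ℝ) - q.2.2.1) * ((p.2.2.1 : ℝ) - q.2.2.1) + 11 * ((p.2.2.2 : ℝ) - q.2.2.2) * ((p.2.2.2 : ℝ) - q.2.2.2) = 144 := by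
    exact_mod_cast h1
  have h2' : ((p.1 : ℝ) - q.1) * ((p.2.1 : ℝ) - q.2.1) + ((p.2.2.1 : ℝ) - q.2.2.1) * ((p.2.2.2 : ℝ) - q.2.2.2) = 0 := by
    exact_mod_cast h2
  apply norm_eq_one_of_normSq
  rw [pt33_sub, Complex.normSq_mk]
  exact normSq_form33 _ _ _ _ h1' h2'

/-- `unitB5 p q` ⇒ `pt5 p`, `pt5 q` are at distance `1`. -/
theorem norm_sub_pt5 {p q : ℤ × ℤ × ℤ × ℤ} (h : unitB5 p q = true) : ‖pt5 p - pt5 q‖ = 1 := by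
  simp only [unitB5, Bool.and_eq_true, beq_iff_eq] at h
  obtain ⟨h1, h2⟩ := h
  have h1' : ((p.1 : ℝ) - q.1) * ((p.1 : ℝ) - q.1) + 5 * ((p.2.1 : ℝ) - q.2.1) * ((p.2.1 : ℝ) - q.2.1) +
      3 * ((p.2.2.1 : ℝ) - q.2.2.1) * ((p.2.2.1 : ℝ) - q.2.2.1) + 15 * ((p.2.2.2 : ℝ) - q.2.2.2) * ((p.2.2.2 : ℝ) - q.2.2.2) = 256 := by
    exact_mod_cast h1
  have h2' : ((p.1 : ℝ) - q.1) * ((p.2.1 : ℝ) - q.2.1) + 3 * ((p.2.2.1 : ℝ) - q.2.2.1) * ((p.2.2.2 : ℝ) - q.2.2.2) = 0 := by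
    exact_mod_cast h2
  apply norm_eq_one_of_normSq
  rw [pt5_sub, Complex.normSq_mk, normSq_form5 _ _ _ _ 256 h1' h2']
  norm_num

/-- `orientedB5 p q r` ⇒ `(pt5 p; pt5 q, pt5 r)` is a positively oriented equilateral `√3`-triple. -/
theorem otriple_pt5 {p q r : ℤ × ℤ × ℤ × ℤ} (h : orientedB5 p q r = true) : IsOTriple (pt5 p) (pt5 q) (pt5 r) := by
  simp only [orientedB5, Bool.and_eq_true, beq_iff_eq] at h
  obtain ⟨⟨⟨⟨⟨h1, h2⟩, h3⟩, h4⟩, h5⟩, h6⟩ := h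
  have h1' : ((q.1 : ℝ) - p.1) * ((q.1 : ℝ) - p.1) + 5 * ((q.2.1 : ℝ) - p.2.1) * ((q.2.1 : ℝ) - p.2.1) +
      3 * ((q.2.2.1 : ℝ) - p.2.2.1) * ((q.2.2.1 : ℝ) - p.2.2.1) + 15 * ((q.2.2.2 : ℝ) - p.2.2.2) * ((q.2.2.2 : ℝ) - p.2.2.2) = 768 := by
    exact_mod_cast h1
  have h2' : ((q.1 : ℝ) - p.1) * ((q.2.1 : ℝ) - p.2.1) + 3 * ((q.2.2.1 : ℝ) - p.2.2.1) * ((q.2.2.2 : ℝ) - p.2.2.2) = 0 := by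
    exact_mod_cast h2
  have h3' : 2 * ((r.1 : ℝ) - p.1) = ((q.1 : ℝ) - p.1) - 3 * ((q.2.2.1 : ℝ) - p.2.2.1) := by exact_mod_cast h3
  have h4' : 2 * ((r.2.1 : ℝ) - p.2.1) = ((q.2.1 : ℝ) - p.2.1) - 3 * ((q.2.2.2 : ℝ) - p.2.2.2) := by exact_mod_cast h4
  have h5' : 2 * ((r.2.2.1 : ℝ) - p.2.2.1) = ((q.1 : ℝ) - p.1) + ((q.2.2.1 : ℝ) - p.2.2.1) := by exact_mod_cast h5
  have h6' : 2 * ((r.2.2.2 : ℝ) - p.2.2.2) = ((q.2.1 : ℝ) - p.2.1) + ((q.2.2.2 : ℝ) - p.2.2.2) := by exact_mod_cast h6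
  refine ⟨?_, ?_⟩
  · rw [norm_sq_eq_normSq, pt5_sub, Complex.normSq_mk, normSq_form5 _ _ _ _ 768 h1' h2']
    norm_num
  · rw [pt5_sub, pt5_sub, omegaC]
    apply Complex.ext
    · simp only [Complex.mul_re]
      exact omega_mul_form5_re _ _ _ _ _ _ h3' h4'
    · simp only [Complex.mul_im]
      exact omega_mul_form5_im _ _ _ _ _ _ h5' h6'

/-! ## Direct isometries of `ℂ` -/

/-- The direct similarity `w ↦ x + u·(w − p)`; with `‖u‖ = 1` it is a direct isometry. -/
noncomputable def simil (x u p : ℂ) (w : ℂ) : ℂ := x + u * (w - p)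

/-- A direct similarity acts on differences by multiplication with `u`. -/
theorem simil_sub (x u p a b : ℂ) : simil x u p a - simil x u p b = u * (a - b) := by
  unfold simil; ring

/-- With `‖u‖ = 1` the similarity preserves distances. -/
theorem norm_simil_sub {x u p : ℂ} (hu : ‖u‖ = 1) (a b : ℂ) : ‖simil x u p a - simil x u p b‖ = ‖a - b‖ := by
  rw [simil_sub, norm_mul, hu, one_mul]

/-- A direct isometry maps positively oriented `√3`-triples to positively oriented `√3`-triples. -/
theorem simil_otriple {x u p : ℂ} (hu : ‖u‖ = 1) {a b c : ℂ} (h : IsOTriple a b c) :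
    IsOTriple (simil x u p a) (simil x u p b) (simil x u p c) := by
  obtain ⟨h1, h2⟩ := h
  refine ⟨by rw [norm_simil_sub hu, h1], ?_⟩
  rw [simil_sub, simil_sub, h2]; ring

/-- Norm-one ratio of two vectors of equal non-zero length. -/
theorem norm_div_eq_one {s t : ℂ} (hs : ‖s‖ ^ 2 = 3) (ht : ‖t‖ ^ 2 = 3) : ‖s / t‖ = 1 := by
  have ht0 : ‖t‖ ≠ 0 := by intro h; rw [h] at ht; norm_num at ht
  have : ‖s‖ = ‖t‖ := by nlinarith [norm_nonneg s, norm_nonneg t]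
  rw [norm_div, this, div_self ht0]

/-! ## Part 1 transported: no monochromatic oriented `√3`-triple -/

/-- `M`'s central triple is `(1; ω², ω⁴)`, a positively oriented `√3`-triple, in the coordinates `pt33 ∘ M1345co`. -/
theorem M1345_central_otriple : IsOTriple (pt33 (M1345co 37)) (pt33 (M1345co 40)) (pt33 (M1345co 42)) := by
  have e1 : M1345co 37 = (12, 0, 0, 0) := by decide +kernel
  have e2 : M1345co 40 = (-6, 0, 6, 0) := by decide +kernel
  have e3 : M1345co 42 = (-6, 0, -6, 0) := by decide +kernel
  rw [e1, e2, e3]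
  refine ⟨?_, ?_⟩
  · rw [norm_sq_eq_normSq, pt33_sub, Complex.normSq_mk]
    push_cast
    linear_combination (1 / 4 : ℝ) * (Real.mul_self_sqrt (show (0 : ℝ) ≤ 3 by norm_num))
  · rw [pt33_sub, pt33_sub, omegaC]
    apply Complex.ext
    · simp only [Complex.mul_re]; push_cast; linear_combination (1 / 4 : ℝ) * (Real.mul_self_sqrt (show (0 : ℝ) ≤ 3 by norm_num))
    · simp only [Complex.mul_im]; push_cast; ring

/-- PART 1 IN THE PLANE: no 4-colouring of the unit-distance graph of `ℂ` is constant on a positively oriented equilateral `√3`-triple. -/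
theorem planeC_no_mono_otriple (C : planeGraphC.Coloring (Fin 4)) {x y z : ℂ} (h : IsOTriple x y z) :
    ¬ (C x = C y ∧ C y = C z) := by
  rintro ⟨hxy, hyz⟩
  -- the direct isometry taking `M`'s central triple `(P₁; P₂, P₃)` to `(x; y, z)`
  set P₁ := pt33 (M1345co 37) with hP₁
  set P₂ := pt33 (M1345co 40) with hP₂
  set P₃ := pt33 (M1345co 42) with hP₃
  obtain ⟨hM1, hM2⟩ := M1345_central_otriple
  have hu : ‖(y - x) / (P₂ - P₁)‖ = 1 := norm_div_eq_one h.1 hM1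
  let φ : ℂ → ℂ := simil x ((y - x) / (P₂ - P₁)) P₁
  have hP21 : P₂ - P₁ ≠ 0 := by
    intro h0; rw [h0, norm_zero] at hM1; norm_num at hM1
  have hφ1 : φ P₁ = x := by simp [φ, simil]
  have hφ2 : φ P₂ = y := by
    show x + (y - x) / (P₂ - P₁) * (P₂ - P₁) = y
    rw [div_mul_cancel₀ _ hP21]; ring
  have hφ3 : φ P₃ = z := by
    show x + (y - x) / (P₂ - P₁) * (P₃ - P₁) = z
    rw [hM2, show (y - x) / (P₂ - P₁) * (omegaC * (P₂ - P₁)) = omegaC * ((y - x) / (P₂ - P₁) * (P₂ - P₁)) by ring,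
      div_mul_cancel₀ _ hP21, ← h.2]; ring
  -- the induced colouring of `M`
  let col : ℕ → ℕ := fun v => (C (φ (pt33 (M1345co v)))).val
  have hP : KBits11S.Proper M1345nb 1345 col := by
    intro v hv
    refine ⟨(C (φ (pt33 (M1345co v)))).isLt, ?_⟩
    intro w _ hbit heq
    have hd : ‖pt33 (M1345co v) - pt33 (M1345co w)‖ = 1 := norm_sub_pt33 (M1345_unit_of_testBit v w hv hbit)
    have hadj : planeGraphC.Adj (φ (pt33 (M1345co v))) (φ (pt33 (M1345co w))) := by
      show ‖φ (pt33 (M1345co v)) - φ (pt33 (M1345co w))‖ = 1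
      rw [norm_simil_sub hu, hd]
    exact C.valid hadj (Fin.ext heq).symm
  refine M1345_no_mono_triple hP ⟨?_, ?_⟩
  · show (C (φ P₁)).val = (C (φ P₂)).val; rw [hφ1, hφ2, hxy]
  · show (C (φ P₂)).val = (C (φ P₃)).val; rw [hφ2, hφ3, hyz]

/-! ## Part 2 transported: points at distance 4 are monochromatic -/

/-- PART 2 IN THE PLANE: in a 4-colouring of `ℂ` with no monochromatic oriented `√3`-triple, points at distance `4` have equal colours. -/
theorem planeC_dist_four (C : planeGraphC.Coloring (Fin 4)) {P Q : ℂ} (hPQ : ‖Q - P‖ = 4) : C P = C Q := by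
  have hA : pt5 (K61co 0) = 2 := by
    rw [K61co_special.1]; apply Complex.ext <;> norm_num [pt5]
  have hB : pt5 (K61co 1) = -2 := by
    rw [K61co_special.2.1]; apply Complex.ext <;> norm_num [pt5]
  -- direct isometry with `2 ↦ P`, `−2 ↦ Q`
  let u : ℂ := (Q - P) / (-4)
  have hu : ‖u‖ = 1 := by
    show ‖(Q - P) / (-4)‖ = 1
    rw [norm_div, hPQ]; norm_num
  let ψ : ℂ → ℂ := simil P u 2
  have hψA : ψ 2 = P := by simp [ψ, simil]
  have hψB : ψ (-2) = Q := by
    show P + (Q - P) / (-4) * (-2 - 2) = Q; ring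
  let col : ℕ → ℕ := fun v => (C (ψ (pt5 (K61co v)))).val
  have hP : KTri.Proper K61nb K61tp 61 col := by
    intro v hv
    refine ⟨(C (ψ (pt5 (K61co v)))).isLt, ?_, ?_⟩
    · intro w _ hbit heq
      have hd : ‖pt5 (K61co v) - pt5 (K61co w)‖ = 1 := norm_sub_pt5 (K61_unit_of_testBit v w hv hbit)
      have hadj : planeGraphC.Adj (ψ (pt5 (K61co v))) (ψ (pt5 (K61co w))) := by
        show ‖ψ (pt5 (K61co v)) - ψ (pt5 (K61co w))‖ = 1
        rw [norm_simil_sub hu, hd]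
      exact C.valid hadj (Fin.ext heq).symm
    · intro p hp ⟨e1, e2⟩
      have hot : IsOTriple (ψ (pt5 (K61co v))) (ψ (pt5 (K61co p.1))) (ψ (pt5 (K61co p.2))) :=
        simil_otriple hu (otriple_pt5 (K61tp_oriented v hv p hp))
      exact planeC_no_mono_otriple C hot ⟨(Fin.ext e1).symm, Fin.ext (e1.trans e2.symm)⟩
  have h01 := K61_linking_diagonal hP
  have : C (ψ (pt5 (K61co 0))) = C (ψ (pt5 (K61co 1))) := Fin.ext h01
  rwa [hA, hB, hψA, hψB] at this

/-! ## The contradiction and the transfer to `EuclideanSpace ℝ (Fin 2)` -/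

/-- The unit-distance graph of `ℂ` is not 4-colourable. -/
theorem planeC_not_colorable_four : ¬ planeGraphC.Colorable 4 := by
  rintro ⟨C⟩
  -- `0`, `4` and `R = (31 + 3√7 i)/8`: `|4 − 0| = |R − 0| = 4`, `|4 − R| = 1`
  let R : ℂ := ⟨31 / 8, 3 * Real.sqrt 7 / 8⟩
  have h04 : ‖(4 : ℂ) - 0‖ = 4 := by simp
  have h0R : ‖R - 0‖ = 4 := by
    rw [sub_zero, Complex.norm_def, Complex.normSq_mk]
    rw [show (31 / 8 : ℝ) * (31 / 8) + 3 * Real.sqrt 7 / 8 * (3 * Real.sqrt 7 / 8) = 4 * 4 by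
      linear_combination (9 / 64 : ℝ) * ms_sqrt7]
    exact Real.sqrt_mul_self (by norm_num)
  have h4R : ‖(4 : ℂ) - R‖ = 1 := by
    apply norm_eq_one_of_normSq
    rw [show (4 : ℂ) - R = ⟨4 - 31 / 8, 0 - 3 * Real.sqrt 7 / 8⟩ from by
      apply Complex.ext <;> simp [R]]
    rw [Complex.normSq_mk]
    linear_combination (9 / 64 : ℝ) * ms_sqrt7
  have h1 : C 0 = C 4 := planeC_dist_four C h04
  have h2 : C 0 = C R := planeC_dist_four C h0R
  exact C.valid (show planeGraphC.Adj 4 R from h4R) (h1.symm.trans h2)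

/-- DE GREY'S THEOREM IN THE KERNEL: the unit-distance graph of the Euclidean plane is not 4-colourable. -/
theorem plane_not_colorable_four : ¬ planeUnitDistanceGraph.Colorable 4 := by
  rintro ⟨C⟩
  apply planeC_not_colorable_four
  let e : ℂ ≃ₗᵢ[ℝ] EuclideanSpace ℝ (Fin 2) := Complex.orthonormalBasisOneI.repr
  refine ⟨SimpleGraph.Coloring.mk (fun z => C (e z)) ?_⟩
  intro z w hzw
  apply C.valid
  show dist (e z) (e w) = 1
  rw [dist_eq_norm, ← map_sub, LinearIsometryEquiv.norm_map]
  exact hzw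

/-- `5 ≤ χ(ℝ²)` (de Grey 2018), kernel-checked with standard axioms. -/
theorem five_le_chromaticNumber_plane : 5 ≤ planeUnitDistanceGraph.chromaticNumber := by
  by_contra hlt
  have hlt' : planeUnitDistanceGraph.chromaticNumber < (4 : ℕ∞) + 1 := lt_of_not_ge hlt
  have hle : planeUnitDistanceGraph.chromaticNumber ≤ (4 : ℕ) := Order.le_of_lt_add_one hlt'
  exact plane_not_colorable_four (SimpleGraph.chromaticNumber_le_iff_colorable.mp hle)

end Summit.Ventures.DiscreteObjects.UnitDistance
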